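import Summits.BirchSwinnertonDyer.BirchSwinnertonDyer.Theorems.KimAtThreeD7uTamagawaSharpLevel
import HarnessLib

/-!
# The TAMAGAWA-DIVISIBLE bad places, XIX: the IDENTIFICATION `KS(E[3^{k+1}·3], 𝓕_u) = incl_* KS(E[3], 𝓕̄_can)`
# and `#KS(E[3^{k+1}·3], 𝓕_u) = #KS(E[3], 𝓕̄_can)` at the first level past the threshold `k + 1 = max_ℓ v₃(c_ℓ)`
# (cell `bsd-addord`, seat w2-tamdiv gen 6; route W2 `KimAtThreeKolyvagin`, items 19562 / 19679 / 19599 /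
# 19560, «TamDiv∞» at Kolyvagin-system level)

HONEST FRAMING: TOOL theorems (no definition, no named fact, no `sorry`); closes nothing by itself;
nothing is booked; BSD is not proved by any of this.  Conditional on exactly the binders of part XVIII §3
(= part XV's, read one level up, plus the datum `D₁` on `E[3]`) and the maximality hypothesis
`3^{v₃(c_w)} ∣ 3^{k+1}` at every finite `w ∤ 3`.

## What

* **`isKolyvaginSystem_blochKatoRelaxed_iff_exists_map_torsionInclusion_eq`**: when `3^{k+1} ∣ c_ℓ` for one
  `ℓ ∤ 3` and `v₃(c_w) ≤ k + 1` for all `w ∤ 3` (i.e. `k + 1 = max_ℓ v₃(c_ℓ)`), a family `κ` is a Kolyvagin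
  system of `(E[3^{k+1}·3], 𝓕_u, D (k+1))` IFF `κ = incl_* λ` for a Kolyvagin system `λ` of
  `(E[3], 𝓕̄_can, D₁)` — (⇒) part XVIII §3; (⇐) part XVII §5 at `j = 0`, read on `E[3]` through the
  definitional identifications `E[3] = E[3^0·3]`, `𝓕̄_can = 𝓕_can^{(0)}`.
* **`natCard_kolyvaginSystems_blochKatoRelaxed_eq`**: `λ ↦ incl_* λ` is a bijection, so
  `#KS(E[3^{k+1}·3], 𝓕_u, D (k+1)) = #KS(E[3], 𝓕̄_can, D₁)` (`= 3` under [S24] Thm. 4.4 (1)), while one level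
  lower `KS(E[3^k·3], 𝓕_u, D k) = 0` (part XV).  READING: the module of `𝓕_u`-Kolyvagin systems measures
  `max_ℓ v₃(c_ℓ)` EXACTLY — no trace of the other Tamagawa primes survives at module level (Büyükboduk's
  Question 1 on `κ^{Kato} ∈ (∏ c_ℓ)·KS(T_pE)` concerns Kato's system itself and stays open in print).

References: K. Büyükboduk, JNT 129 (2009) Thm. 3.1, §4.2 Questions 1–2; B. Mazur, K. Rubin, Mem. AMS 799
(2004) App. A Remark A.5; R. Sakamoto, JTNB 36 (2024) Thm. 4.4 (1); R. Greenberg, LNM 1716 §2.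
-/

noncomputable section

-- the cell's Theorems namespace `Summit.BirchSwinnertonDyer.BirchSwinnertonDyer.…` repeats the summit name by design (D-0017)
set_option linter.dupNamespace false

open scoped Classical NumberField ContRepresentation
open Function Field NumberField IsDedekindDomain Module
open WeierstrassCurve Literature.NumberTheory.EllipticCurves Literature.NumberTheory.GaloisRepresentations
  Literature.NumberTheory.GaloisRepresentations.DiscreteGaloisModule Literature.NumberTheory.GaloisCohomology
open Summit.BirchSwinnertonDyer.Rank1Residual Summit.BirchSwinnertonDyer.Rank1Residual.GaloisImage
open Summit.BirchSwinnertonDyer.Rank1Residual.GaloisImage.KSDevissage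
open Summit.BirchSwinnertonDyer.Rank1Residual.GaloisImage.TorsionLevel

namespace Summit.BirchSwinnertonDyer.BirchSwinnertonDyer.Theorems.KimAtThreeD7uTamagawaSharp

section Three

variable (W : WeierstrassCurve ℚ) [W.IsElliptic]

/-! ### §4 `p = 3`: the IDENTIFICATION `KS(E[3^{k+1}·3], 𝓕_u) = incl_* KS(E[3], 𝓕̄_can)` at the first level
past the threshold -/

/-- **`KS(E[3^{k+1}·3], 𝓕_u, D (k+1)) = incl_* KS(E[3], 𝓕̄_can, D₁)` when `k + 1 = max_ℓ v₃(c_ℓ)`** (both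
inclusions): under the binders of `exists_isKolyvaginSystem_map_torsionInclusion_eq` (in particular
`3^{k+1} ∣ c_ℓ` for ONE `ℓ ∤ 3`) and `3^{v₃(c_w)} ∣ 3^{k+1}` at EVERY finite `w ∤ 3` (i.e. `k + 1` IS the
maximal exponent), a family `κ` is a Kolyvagin system of `(E[3^{k+1}·3], 𝓕_u, D (k+1))` iff it is `incl_* λ`
for a Kolyvagin system `λ` of `(E[3], 𝓕̄_can = propagatedSelmerStructureOne W 3, D₁)` — (⇒) §3, (⇐) part XVII
§5 (`isKolyvaginSystem_map_torsionInclusion_blochKatoRelaxed` at `j = 0`, read on `E[3]` through the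
definitional identifications `E[3] = E[3^0·3]`, `𝓕̄_can = 𝓕_can^{(0)}`).  So at the first level past the
threshold the module of `𝓕_u`-Kolyvagin systems is NOT zero but a copy of `KS(E[3], 𝓕̄_can)` (free of rank
one over `𝔽₃`, [S24] Thm. 4.4 (1)): the Kolyvagin-system form of «TamDiv∞» stops EXACTLY at `max_ℓ v₃(c_ℓ)`.
[cite: Buyukboduk2009TamagawaDefect, Thm. 3.1 and §4.2 Questions 1–2] [cite: MazurRubin2004, App. A Remark A.5 (p. 81)]
[cite: Sakamoto2024, Thm. 4.4 (1) (p. 926)] -/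
theorem isKolyvaginSystem_blochKatoRelaxed_iff_exists_map_torsionInclusion_eq
    [Finite (geomTorsion W ((3 : ℕ) : ℤ))] [Finite (geomTorsion W (((3 : ℕ) : ℤ) ^ 0 * ((3 : ℕ) : ℤ)))]
    {inv : LocalInvariants ℚ 3}
    (hperf : inv.IsPerfect) (hsum : inv.SumLocalTermEqZero) (hcompl : inv.SelmerComplement)
    (hEP : ∀ v : HeightOneSpectrum (𝓞 ℚ), localEulerPoincareCharacteristic (v.adicCompletion ℚ))
    (T : Finset (HeightOneSpectrum (𝓞 ℚ)))
    (h3T : ∀ v : HeightOneSpectrum (𝓞 ℚ), ((3 : ℕ) : 𝓞 ℚ) ∈ v.asIdeal → v ∈ T)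
    (hbadT : ∀ v : HeightOneSpectrum (𝓞 ℚ), ¬ W.HasGoodReductionAt v → v ∈ T) (k : ℕ)
    {ℓ : HeightOneSpectrum (𝓞 ℚ)} (h3ℓ : ((3 : ℕ) : 𝓞 ℚ) ∉ ℓ.asIdeal)
    (hk : 3 ^ (k + 1) ∣ (W.baseChange (ℓ.adicCompletion ℚ)).localTamagawaNumber (ℓ.adicCompletionIntegers ℚ))
    (htam : ∀ w : HeightOneSpectrum (𝓞 ℚ), ((3 : ℕ) : 𝓞 ℚ) ∉ w.asIdeal →
      3 ^ padicValNat 3 ((W.baseChange (w.adicCompletion ℚ)).localTamagawaNumber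
        (w.adicCompletionIntegers ℚ)) ∣ 3 ^ (k + 1))
    (h0 : ∀ (j : ℕ) (P : geomTorsion W (((3 : ℕ) : ℤ) ^ j * ((3 : ℕ) : ℤ))),
      (∀ σ : absoluteGaloisGroup ℚ,
        W.torsionGaloisModule (((3 : ℕ) : ℤ) ^ j * ((3 : ℕ) : ℤ)) σ P = P) → P = 0)
    {Sset : Set (HeightOneSpectrum (𝓞 ℚ))} {τ : absoluteGaloisGroup ℚ}
    (hτ : ∀ j : ℕ, Nonempty (cokerSubOne (W.torsionGaloisModule (((3 : ℕ) : ℤ) ^ j * ((3 : ℕ) : ℤ))) τ ≃+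
      ZMod (3 ^ (j + 1))))
    (hτ₁ : Nonempty (cokerSubOne (W.torsionGaloisModule ((3 : ℕ) : ℤ)) τ ≃+ ZMod 3))
    (hτμ : τ ∈ rootsOfUnityFixer ℚ (3 ^ (k + 1 + 1)))
    (D : (j : ℕ) → KolyvaginDatum (W.torsionGaloisModule (((3 : ℕ) : ℤ) ^ j * ((3 : ℕ) : ℤ))))
    (D₁ : KolyvaginDatum (W.torsionGaloisModule ((3 : ℕ) : ℤ)))
    {P : Set (HeightOneSpectrum (𝓞 ℚ))} (hP : ∀ j, (D j).primes = P) (hP₁ : D₁.primes = P)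
    (hPT : ∀ q ∈ P, q ∉ T)
    (hPc : P ⊆ frobeniusClassPrimes
      (W.torsionGaloisModule (((3 : ℕ) : ℤ) ^ (k + 1) * ((3 : ℕ) : ℤ))) Sset τ (3 ^ (k + 1 + 1)))
    (hT : ∀ j, (D j).transverse = cyclotomicTransverse _) (hT₁ : D₁.transverse = cyclotomicTransverse _)
    {η : (q : HeightOneSpectrum (𝓞 ℚ)) → (ZMod (Ideal.absNorm q.asIdeal))ˣ}
    (hD : ∀ j, (D j).HasCanonicalComparison (3 ^ (j + 1)) η) (hD₁ : D₁.HasCanonicalComparison 3 η)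
    (hadm : ∀ j, (D j).IsAdmissible)
    (hprime : ∀ c : galoisCohomology (W.torsionGaloisModule (((3 : ℕ) : ℤ) ^ 0 * ((3 : ℕ) : ℤ))) 1, c ≠ 0 →
      ∀ c' : galoisCohomology (DiscreteGaloisModule.tateDual
        (W.torsionGaloisModule (((3 : ℕ) : ℤ) ^ 0 * ((3 : ℕ) : ℤ))) 3) 1, c' ≠ 0 →
      {q ∈ (D 0).primes |
        galoisCohomology.localization (W.torsionGaloisModule (((3 : ℕ) : ℤ) ^ 0 * ((3 : ℕ) : ℤ)))
          (Sum.inr q) 1 c ≠ 0 ∧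
        galoisCohomology.localization (DiscreteGaloisModule.tateDual
          (W.torsionGaloisModule (((3 : ℕ) : ℤ) ^ 0 * ((3 : ℕ) : ℤ))) 3) (Sum.inr q) 1 c' ≠ 0}.Infinite)
    (κ : Finset (HeightOneSpectrum (𝓞 ℚ)) →
      galoisCohomology (W.torsionGaloisModule (((3 : ℕ) : ℤ) ^ (k + 1) * ((3 : ℕ) : ℤ))) 1) :
    (D (k + 1)).IsKolyvaginSystem (blochKatoSelmerStructure 3 (tateTorsionDatum W 3 (k + 1)) (fun _ _ => ⊤)) κ ↔
      ∃ lam : Finset (HeightOneSpectrum (𝓞 ℚ)) → galoisCohomology (W.torsionGaloisModule ((3 : ℕ) : ℤ)) 1,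
        D₁.IsKolyvaginSystem (propagatedSelmerStructureOne W 3) lam ∧
          ∀ d, galoisCohomology.map (W.torsionInclusion (three_dvd_pow_succ_mul k)) 1 (lam d) = κ d := by
  haveI : Fact (Nat.Prime 3) := ⟨Nat.prime_three⟩
  refine ⟨fun hκ => exists_isKolyvaginSystem_map_torsionInclusion_eq W hperf hsum hcompl hEP T h3T hbadT k h3ℓ
    hk h0 hτ hτ₁ hτμ D D₁ hP hP₁ hPT hPc hT hT₁ hD hD₁ hadm hprime hκ, ?_⟩
  rintro ⟨lam, hlam, hEq⟩
  rw [show κ = (fun d => galoisCohomology.map (W.torsionInclusion (three_dvd_pow_succ_mul k)) 1 (lam d)) from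
    funext fun d => (hEq d).symm]
  -- part XVII §5 at `j = 0`, read on `E[3]` (`E[3] = E[3^0·3]`, `𝓕̄_can = 𝓕_can^{(0)}` definitionally)
  exact isKolyvaginSystem_map_torsionInclusion_blochKatoRelaxed W 3 (j := 0) (k := k + 1) (Nat.zero_le _)
    (fun w hw => by rw [Nat.sub_zero]; exact htam w hw) T h3T hbadT (Dj := D₁) (Dk := D (k + 1))
    ((hP (k + 1)).trans hP₁.symm) (fun q hq => hPT q (hP₁ ▸ hq)) hT₁ (hT (k + 1)) hD₁ (hD (k + 1)) hlam

/-- **`#KS(E[3^{k+1}·3], 𝓕_u, D (k+1)) = #KS(E[3], 𝓕̄_can, D₁)` at the first level past the threshold**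
(`= 3` under [S24] Thm. 4.4 (1)): `λ ↦ incl_* λ` is a bijection between the two groups of Kolyvagin systems
(injective: no `Γ_ℚ`-fixed points, part XVII §6; surjective: §3).  One level lower every `𝓕_u`-Kolyvagin
system vanishes (part XV). [cite: Buyukboduk2009TamagawaDefect, Thm. 3.1 and §4.2 Questions 1–2]
[cite: Sakamoto2024, Thm. 4.4 (1) (p. 926)] -/
theorem natCard_kolyvaginSystems_blochKatoRelaxed_eq
    [Finite (geomTorsion W ((3 : ℕ) : ℤ))] [Finite (geomTorsion W (((3 : ℕ) : ℤ) ^ 0 * ((3 : ℕ) : ℤ)))]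
    {inv : LocalInvariants ℚ 3}
    (hperf : inv.IsPerfect) (hsum : inv.SumLocalTermEqZero) (hcompl : inv.SelmerComplement)
    (hEP : ∀ v : HeightOneSpectrum (𝓞 ℚ), localEulerPoincareCharacteristic (v.adicCompletion ℚ))
    (T : Finset (HeightOneSpectrum (𝓞 ℚ)))
    (h3T : ∀ v : HeightOneSpectrum (𝓞 ℚ), ((3 : ℕ) : 𝓞 ℚ) ∈ v.asIdeal → v ∈ T)
    (hbadT : ∀ v : HeightOneSpectrum (𝓞 ℚ), ¬ W.HasGoodReductionAt v → v ∈ T) (k : ℕ)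
    {ℓ : HeightOneSpectrum (𝓞 ℚ)} (h3ℓ : ((3 : ℕ) : 𝓞 ℚ) ∉ ℓ.asIdeal)
    (hk : 3 ^ (k + 1) ∣ (W.baseChange (ℓ.adicCompletion ℚ)).localTamagawaNumber (ℓ.adicCompletionIntegers ℚ))
    (htam : ∀ w : HeightOneSpectrum (𝓞 ℚ), ((3 : ℕ) : 𝓞 ℚ) ∉ w.asIdeal →
      3 ^ padicValNat 3 ((W.baseChange (w.adicCompletion ℚ)).localTamagawaNumber
        (w.adicCompletionIntegers ℚ)) ∣ 3 ^ (k + 1))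
    (h0 : ∀ (j : ℕ) (P : geomTorsion W (((3 : ℕ) : ℤ) ^ j * ((3 : ℕ) : ℤ))),
      (∀ σ : absoluteGaloisGroup ℚ,
        W.torsionGaloisModule (((3 : ℕ) : ℤ) ^ j * ((3 : ℕ) : ℤ)) σ P = P) → P = 0)
    {Sset : Set (HeightOneSpectrum (𝓞 ℚ))} {τ : absoluteGaloisGroup ℚ}
    (hτ : ∀ j : ℕ, Nonempty (cokerSubOne (W.torsionGaloisModule (((3 : ℕ) : ℤ) ^ j * ((3 : ℕ) : ℤ))) τ ≃+
      ZMod (3 ^ (j + 1))))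
    (hτ₁ : Nonempty (cokerSubOne (W.torsionGaloisModule ((3 : ℕ) : ℤ)) τ ≃+ ZMod 3))
    (hτμ : τ ∈ rootsOfUnityFixer ℚ (3 ^ (k + 1 + 1)))
    (D : (j : ℕ) → KolyvaginDatum (W.torsionGaloisModule (((3 : ℕ) : ℤ) ^ j * ((3 : ℕ) : ℤ))))
    (D₁ : KolyvaginDatum (W.torsionGaloisModule ((3 : ℕ) : ℤ)))
    {P : Set (HeightOneSpectrum (𝓞 ℚ))} (hP : ∀ j, (D j).primes = P) (hP₁ : D₁.primes = P)
    (hPT : ∀ q ∈ P, q ∉ T)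
    (hPc : P ⊆ frobeniusClassPrimes
      (W.torsionGaloisModule (((3 : ℕ) : ℤ) ^ (k + 1) * ((3 : ℕ) : ℤ))) Sset τ (3 ^ (k + 1 + 1)))
    (hT : ∀ j, (D j).transverse = cyclotomicTransverse _) (hT₁ : D₁.transverse = cyclotomicTransverse _)
    {η : (q : HeightOneSpectrum (𝓞 ℚ)) → (ZMod (Ideal.absNorm q.asIdeal))ˣ}
    (hD : ∀ j, (D j).HasCanonicalComparison (3 ^ (j + 1)) η) (hD₁ : D₁.HasCanonicalComparison 3 η)
    (hadm : ∀ j, (D j).IsAdmissible)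
    (hprime : ∀ c : galoisCohomology (W.torsionGaloisModule (((3 : ℕ) : ℤ) ^ 0 * ((3 : ℕ) : ℤ))) 1, c ≠ 0 →
      ∀ c' : galoisCohomology (DiscreteGaloisModule.tateDual
        (W.torsionGaloisModule (((3 : ℕ) : ℤ) ^ 0 * ((3 : ℕ) : ℤ))) 3) 1, c' ≠ 0 →
      {q ∈ (D 0).primes |
        galoisCohomology.localization (W.torsionGaloisModule (((3 : ℕ) : ℤ) ^ 0 * ((3 : ℕ) : ℤ)))
          (Sum.inr q) 1 c ≠ 0 ∧
        galoisCohomology.localization (DiscreteGaloisModule.tateDual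
          (W.torsionGaloisModule (((3 : ℕ) : ℤ) ^ 0 * ((3 : ℕ) : ℤ))) 3) (Sum.inr q) 1 c' ≠ 0}.Infinite) :
    Nat.card ((D (k + 1)).kolyvaginSystems
        (blochKatoSelmerStructure 3 (tateTorsionDatum W 3 (k + 1)) (fun _ _ => ⊤))) =
      Nat.card (D₁.kolyvaginSystems (propagatedSelmerStructureOne W 3)) := by
  haveI : Fact (Nat.Prime 3) := ⟨Nat.prime_three⟩
  have hiff := isKolyvaginSystem_blochKatoRelaxed_iff_exists_map_torsionInclusion_eq W hperf hsum hcompl hEP T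
    h3T hbadT k h3ℓ hk htam h0 hτ hτ₁ hτμ D D₁ hP hP₁ hPT hPc hT hT₁ hD hD₁ hadm hprime
  symm
  refine Nat.card_congr (Equiv.ofBijective
    (fun lam => ⟨fun d => galoisCohomology.map (W.torsionInclusion (three_dvd_pow_succ_mul k)) 1 (lam.1 d),
      (KolyvaginDatum.mem_kolyvaginSystems_iff _ _ _).mpr ((hiff _).mpr
        ⟨lam.1, (KolyvaginDatum.mem_kolyvaginSystems_iff _ _ _).mp lam.2, fun _ => rfl⟩)⟩) ⟨?_, ?_⟩)
  · -- injective: no `Γ_ℚ`-fixed point on `E[3^{k+1}·3]` (part XVII §6, through `E[3] = E[3^0·3]`)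
    intro a b hab
    apply Subtype.ext
    have h := congrArg Subtype.val hab
    have hsub : (fun d => galoisCohomology.map (W.torsionInclusion (three_dvd_pow_succ_mul k)) 1
        ((a.1 - b.1) d)) = 0 := by
      funext d
      change galoisCohomology.map _ 1 (a.1 d - b.1 d) = 0
      rw [map_sub, sub_eq_zero]
      exact congrFun h d
    exact sub_eq_zero.mp (eq_zero_of_map_torsionInclusion_eq_zero W 3 (j := 0) (k := k + 1) (Nat.zero_le _)
      (h0 (k + 1)) hsub)
  · -- surjective: §3
    rintro ⟨κ, hκ⟩
    obtain ⟨lam, hlam, hEq⟩ := (hiff κ).mp ((KolyvaginDatum.mem_kolyvaginSystems_iff _ _ _).mp hκ)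
    exact ⟨⟨lam, (KolyvaginDatum.mem_kolyvaginSystems_iff _ _ _).mpr hlam⟩, Subtype.ext (funext hEq)⟩

end Three

end Summit.BirchSwinnertonDyer.BirchSwinnertonDyer.Theorems.KimAtThreeD7uTamagawaSharp

end
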